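import Summits.QuantumFields.YangMills.Theorems.ColdStartUniversalityLatticeLangevinBakryEmeryConcentration
import Summits.QuantumFields.YangMills.Theorems.ColdStartUniversalityLatticeLangevinMixingTimeExplicit
import Literature.Probability.Entropy.GibbsTiltTransport
import HarnessLib

/-!
# Route `ColdStartUniversality` (fixed-cut-off package): TRANSPORT–ENTROPY MIXING — VOLUME-INDEPENDENT cold-start equilibration
# of SMOOTH MACROSCOPIC observables for the SU(2) SZZ dynamics on `(ℤ/L)³` at `|β'| < 1/12`

Helper file (seat `ym-line-csu-p1`, g28; `--supports stmt-QuantumFields-24809`).  g27 obtained the cold-start mixing time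
`2 + log(√(2B_L)/ε)/(1 − 12|β'|) = O(log L)` for ALL bounded observables (Pinsker: `|E g − μg| ≤ √(2·KL)`, budget `B_L = O(L³)`).
For a SMOOTH observable `F = f∘coords` whose carré du champ `Γ(f) = Σ_(ij) ∂_if ∂_jf (σσᵀ)_(ij)` is SMALL (`Γ(f) ≤ s`, typically
`s = O(1/L³)` for a spatial average) the factor `√KL` can be traded against `√s` — the transport–entropy (Bobkov–Götze / Marton)
inequality `|E_ν F − E_μ F| ≤ √(2 v KL(ν ‖ μ))` for a `μ`-sub-Gaussian `F` with variance proxy `v` — and the volume factors CANCEL: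
* ★ `wilson_laplace_le_exp_uniform_real` / ★★ `wilson_logmgf_le_uniform` — the sub-Gaussian Laplace bound of g26 for EVERY REAL `λ`:
  `log ∫ e^(λ(F − μF)) dμ_(β') ≤ (s/(2(1−12|β'|)))·λ²/2`;
* ★★ `wilson_transport_le_sqrt_uniform` — for every probability measure `ν` with `KL(ν ‖ μ_(β')) < ∞`:
  `|∫F dν − ∫F dμ_(β')| ≤ √(s · KL(ν ‖ μ_(β')) / (1 − 12|β'|))` [cite: BoucheronLugosiMassart2013, Lemma 4.18];
* ★★★ `wilson_coldStart_smooth_le_exp_uniform` / `_explicit` — for EVERY solution `U` of the SZZ dynamics from a deterministic start: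
  `|E F(U_(τ₀+u)) − μ_(β')F| ≤ e^(−(1−12|β'|)u) · √(s · KL(law U_(τ₀) ‖ μ_(β')) / (1−12|β'|))`, and with g27's explicit budget
  (`τ₀ = 2`): `≤ e^(−(1−12|β'|)u) · √(s · B_L / (1 − 12|β'|))`, `B_L = 366|β'|L³ + 3 log(3/2) L³ + log 2`;
* ★★★ `wilson_coldStart_smooth_mixingTime` — `u ≥ log(√(s B_L/(1−12|β'|))/ε)/(1−12|β'|) ⇒ |E F(U_(2+u)) − μ_(β')F| ≤ ε`.
Since `s · B_L = O(1)` for spatially averaged observables, their ε-equilibration time from the cold (or any deterministic) start is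
`O(log(1/ε))` lattice units, INDEPENDENT OF THE VOLUME — consequences for the action density and Wilson loops are in the companion file
`…LatticeLangevinMacroscopicMixing`.  (The strong-coupling infinite-volume SZZ dynamics is exponentially ergodic
[cite: ShenZhuZhu2022, §4 Theorem 4.2]; this is its finite-volume, observable-wise shadow obtained from the entropy side, without gradient
bounds.)  HONEST FRAMING: FIXED cut-off and fixed `|β'| < 1/12` (lattice units; "uniform" = in `L` and in the start); the route's scaling
`β'_K → ∞` leaves the window; 24809 ASIDE not restated; nothing K-uniform; no crux, rung or summit statement is proved; the Yang–Mills mass gap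
is NOT proved.  THEOREMS ONLY, no definition, no sorry.
-/

set_option autoImplicit false

noncomputable section

namespace Summit.QuantumFields.YangMills.Theorems.ColdStartUniversality

open MeasureTheory ProbabilityTheory Finset Filter Set InformationTheory
open scoped BigOperators NNReal ENNReal Topology
open Literature.Probability.Process Literature.MathematicalPhysics.QuantumFieldTheory
open Literature.MathematicalPhysics.QuantumLattice (fundamentalRep fundamentalLatticeRep continuous_fundamentalRep)

variable {L : ℕ} [NeZero L]

/-! ## §1. The sub-Gaussian Laplace bound for every real parameter -/

/-- ★ **Two-sided sub-Gaussian Laplace bound under `μ_(β')`, `|β'| < 1/12`.**  For `f ∈ C³` with carré du champ `Γ(f) ≤ s` on `SU(2)^E`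
and EVERY real `λ`: `∫ e^(λF) dμ_(β') ≤ exp(λ ∫F dμ_(β') + s λ²/(4(1 − 12|β'|)))` (`F = f∘coords`; g26's `wilson_laplace_le_exp_uniform`
for `λ ≥ 0`, applied to `−f` — which has the same carré du champ — for `λ < 0`). [cite: ShenZhuZhu2022, §4 Theorem 4.2] -/
theorem wilson_laplace_le_exp_uniform_real (L : ℕ) [NeZero L] (β' : ℝ)
    (f : (Edge 3 L × Fin 2 × Fin 2 × Bool → ℝ) → ℝ) (hf : ContDiff ℝ 3 f) (hβ : |β'| < 1 / 12) (s : ℝ) :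
    let coords : GaugeConfig 3 L (Matrix.specialUnitaryGroup (Fin 2) ℂ) → (Edge 3 L × Fin 2 × Fin 2 × Bool → ℝ) :=
      fun V q => (fun z : ℂ => if q.2.2.2 then z.im else z.re)
        ((fundamentalRep (Fin 2) (V q.1) : Matrix (Fin 2) (Fin 2) ℂ) q.2.1 q.2.2.1)
    let A : GaugeConfig 3 L (Matrix.specialUnitaryGroup (Fin 2) ℂ) → (Edge 3 L × Fin 2 × Fin 2 × Bool) →
        (Edge 3 L × Fin 2 × Fin 2 × Bool) → ℝ := fun V i j =>
      ∑ n : Edge 3 L × NoiseIdx 2,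
        (if n.1 = i.1 then (fun z : ℂ => if i.2.2.2 then z.im else z.re)
          ((latticeLangevinDynamics (fundamentalLatticeRep 2) β').noise
            (matrixConfig (fundamentalRep (Fin 2)) V) i.1 n.2 i.2.1 i.2.2.1) else 0) *
        (if n.1 = j.1 then (fun z : ℂ => if j.2.2.2 then z.im else z.re)
          ((latticeLangevinDynamics (fundamentalLatticeRep 2) β').noise
            (matrixConfig (fundamentalRep (Fin 2)) V) j.1 n.2 j.2.1 j.2.2.1) else 0)
    (∀ V, (∑ i : Edge 3 L × Fin 2 × Fin 2 × Bool, ∑ j : Edge 3 L × Fin 2 × Fin 2 × Bool, fderiv ℝ f (coords V) (Pi.single i 1) * fderiv ℝ f (coords V) (Pi.single j 1) * A V i j) ≤ s) → ∀ l : ℝ,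
      ∫ V, Real.exp (l * f (coords V)) ∂(wilsonMeasure (d := 3) (L := L) (fundamentalRep (Fin 2)) β') ≤
        Real.exp (l * (∫ V, f (coords V) ∂(wilsonMeasure (d := 3) (L := L) (fundamentalRep (Fin 2)) β')) + s / (4 * (1 - 12 * |β'|)) * l ^ 2) := by
  intro coords A hΓ l
  rcases le_or_gt 0 l with hl | hl
  · exact wilson_laplace_le_exp_uniform L β' hβ f hf s hΓ l hl
  · -- apply the one-sided bound to `g = −f` at the parameter `−l ≥ 0`
    have hg : ContDiff ℝ 3 (fun z => -f z) := hf.neg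
    have hΓg : ∀ V, (∑ i : Edge 3 L × Fin 2 × Fin 2 × Bool, ∑ j : Edge 3 L × Fin 2 × Fin 2 × Bool, fderiv ℝ (fun z => -f z) (coords V) (Pi.single i 1) * fderiv ℝ (fun z => -f z) (coords V) (Pi.single j 1) * A V i j) ≤ s := by
      intro V
      have e : (∑ i : Edge 3 L × Fin 2 × Fin 2 × Bool, ∑ j : Edge 3 L × Fin 2 × Fin 2 × Bool, fderiv ℝ (fun z => -f z) (coords V) (Pi.single i 1) * fderiv ℝ (fun z => -f z) (coords V) (Pi.single j 1) * A V i j) =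
          (∑ i : Edge 3 L × Fin 2 × Fin 2 × Bool, ∑ j : Edge 3 L × Fin 2 × Fin 2 × Bool, fderiv ℝ f (coords V) (Pi.single i 1) * fderiv ℝ f (coords V) (Pi.single j 1) * A V i j) := by
        refine Finset.sum_congr rfl fun i _ => Finset.sum_congr rfl fun j _ => ?_
        rw [fderiv_fun_neg]
        simp only [neg_apply]
        ring
      rw [e]
      exact hΓ V
    have h := wilson_laplace_le_exp_uniform L β' hβ (fun z => -f z) hg s hΓg (-l) (by linarith)
    calc ∫ V, Real.exp (l * f (coords V)) ∂(wilsonMeasure (d := 3) (L := L) (fundamentalRep (Fin 2)) β')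
        = ∫ V, Real.exp (-l * (fun z => -f z) (coords V)) ∂(wilsonMeasure (d := 3) (L := L) (fundamentalRep (Fin 2)) β') := by
          refine integral_congr_ae (ae_of_all _ fun V => ?_)
          beta_reduce
          congr 1
          ring
      _ ≤ Real.exp (-l * (∫ V, (fun z => -f z) (coords V) ∂(wilsonMeasure (d := 3) (L := L) (fundamentalRep (Fin 2)) β')) + s / (4 * (1 - 12 * |β'|)) * (-l) ^ 2) := h
      _ = Real.exp (l * (∫ V, f (coords V) ∂(wilsonMeasure (d := 3) (L := L) (fundamentalRep (Fin 2)) β')) + s / (4 * (1 - 12 * |β'|)) * l ^ 2) := by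
          congr 1
          beta_reduce
          rw [integral_neg]
          ring

/-- ★★ **Volume-uniform sub-Gaussian log-moment generating function** under `μ_(β')`, `|β'| < 1/12`: for `f ∈ C³` with `Γ(f) ≤ s`
on `SU(2)^E` and every real `λ`, `log ∫ exp(λ(F − ∫F dμ_(β'))) dμ_(β') ≤ (s/(2(1 − 12|β'|)))·λ²/2` — the centred observable `F = f∘coords`
is sub-Gaussian with variance proxy `v = s/(2(1−12|β'|))`, independently of `L`. [cite: ShenZhuZhu2022, §4 Theorem 4.2] -/
theorem wilson_logmgf_le_uniform (L : ℕ) [NeZero L] (β' : ℝ) (s : ℝ)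
    (f : (Edge 3 L × Fin 2 × Fin 2 × Bool → ℝ) → ℝ) (hf : ContDiff ℝ 3 f) (hβ : |β'| < 1 / 12) :
    let coords : GaugeConfig 3 L (Matrix.specialUnitaryGroup (Fin 2) ℂ) → (Edge 3 L × Fin 2 × Fin 2 × Bool → ℝ) :=
      fun V q => (fun z : ℂ => if q.2.2.2 then z.im else z.re)
        ((fundamentalRep (Fin 2) (V q.1) : Matrix (Fin 2) (Fin 2) ℂ) q.2.1 q.2.2.1)
    let A : GaugeConfig 3 L (Matrix.specialUnitaryGroup (Fin 2) ℂ) → (Edge 3 L × Fin 2 × Fin 2 × Bool) →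
        (Edge 3 L × Fin 2 × Fin 2 × Bool) → ℝ := fun V i j =>
      ∑ n : Edge 3 L × NoiseIdx 2,
        (if n.1 = i.1 then (fun z : ℂ => if i.2.2.2 then z.im else z.re)
          ((latticeLangevinDynamics (fundamentalLatticeRep 2) β').noise
            (matrixConfig (fundamentalRep (Fin 2)) V) i.1 n.2 i.2.1 i.2.2.1) else 0) *
        (if n.1 = j.1 then (fun z : ℂ => if j.2.2.2 then z.im else z.re)
          ((latticeLangevinDynamics (fundamentalLatticeRep 2) β').noise
            (matrixConfig (fundamentalRep (Fin 2)) V) j.1 n.2 j.2.1 j.2.2.1) else 0)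
    (∀ V, (∑ i : Edge 3 L × Fin 2 × Fin 2 × Bool, ∑ j : Edge 3 L × Fin 2 × Fin 2 × Bool, fderiv ℝ f (coords V) (Pi.single i 1) * fderiv ℝ f (coords V) (Pi.single j 1) * A V i j) ≤ s) → ∀ l : ℝ,
      Real.log (∫ V, Real.exp (l * (f (coords V) - ∫ V', f (coords V') ∂(wilsonMeasure (d := 3) (L := L) (fundamentalRep (Fin 2)) β'))) ∂(wilsonMeasure (d := 3) (L := L) (fundamentalRep (Fin 2)) β')) ≤
        s / (2 * (1 - 12 * |β'|)) * l ^ 2 / 2 := by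
  intro coords A hΓ l
  classical
  haveI := secondCountableTopology_su2
  haveI := borelSpace_config L
  set μ : Measure (GaugeConfig 3 L (Matrix.specialUnitaryGroup (Fin 2) ℂ)) := (wilsonMeasure (d := 3) (L := L) (fundamentalRep (Fin 2)) β') with hμ
  haveI : IsProbabilityMeasure μ :=
    isProbabilityMeasure_wilsonMeasure (d := 3) (L := L) (fundamentalRep (Fin 2)) (continuous_fundamentalRep (Fin 2)) β'
  have hlap := wilson_laplace_le_exp_uniform_real L β' f hf hβ s hΓ l
  have hco : Continuous coords := continuous_coords (L := L)
  have hFc : Continuous fun V => f (coords V) := hf.continuous.comp hco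
  set m : ℝ := ∫ V', f (coords V') ∂μ with hm
  -- `∫ e^(λ(F − m)) = e^(−λm) ∫ e^(λF)`
  have e1 : ∫ V, Real.exp (l * (f (coords V) - m)) ∂μ = Real.exp (-(l * m)) * ∫ V, Real.exp (l * f (coords V)) ∂μ := by
    rw [← integral_const_mul]
    refine integral_congr_ae (ae_of_all _ fun V => ?_)
    beta_reduce
    rw [← Real.exp_add]
    congr 1; ring
  have hint : Integrable (fun V => Real.exp (l * (f (coords V) - m))) μ :=
    integrable_of_continuous_of_compactSpace (Real.continuous_exp.comp (continuous_const.mul (hFc.sub continuous_const))) _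
  have hpos : 0 < ∫ V, Real.exp (l * (f (coords V) - m)) ∂μ := integral_exp_pos hint
  rw [Real.log_le_iff_le_exp hpos, e1]
  calc Real.exp (-(l * m)) * ∫ V, Real.exp (l * f (coords V)) ∂μ
      ≤ Real.exp (-(l * m)) * Real.exp (l * m + s / (4 * (1 - 12 * |β'|)) * l ^ 2) :=
        mul_le_mul_of_nonneg_left hlap (Real.exp_pos _).le
    _ = Real.exp (s / (2 * (1 - 12 * |β'|)) * l ^ 2 / 2) := by
        rw [← Real.exp_add]
        congr 1
        have hρ : (1 - 12 * |β'|) ≠ 0 := by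
          have : 0 < 1 - 12 * |β'| := by linarith
          exact this.ne'
        field_simp
        ring

/-! ## §2. The transport–entropy inequality under `μ_(β')` -/

/-- ★★ **Transport–entropy inequality for smooth observables under the Wilson measure, volume-uniform** (`|β'| < 1/12`).
For `f ∈ C³` with `Γ(f) ≤ s` (`s > 0`) on `SU(2)^E` and every probability measure `ν` on `SU(2)^E` with `KL(ν ‖ μ_(β')) < ∞`:
`|∫ F dν − ∫ F dμ_(β')| ≤ √(s · KL(ν ‖ μ_(β')) / (1 − 12|β'|))` (`F = f∘coords`).  Sub-Gaussian log-mgf (`wilson_logmgf_le_uniform`)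
+ the transportation lemma `Literature.Probability.Entropy.abs_integral_sub_integral_le_sqrt_of_subGaussian`.
[cite: BoucheronLugosiMassart2013, Lemma 4.18] -/
theorem wilson_transport_le_sqrt_uniform (L : ℕ) [NeZero L] (β' : ℝ)
    (f : (Edge 3 L × Fin 2 × Fin 2 × Bool → ℝ) → ℝ) (hf : ContDiff ℝ 3 f) {s : ℝ} (hs : 0 < s) (hβ : |β'| < 1 / 12) :
    let coords : GaugeConfig 3 L (Matrix.specialUnitaryGroup (Fin 2) ℂ) → (Edge 3 L × Fin 2 × Fin 2 × Bool → ℝ) :=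
      fun V q => (fun z : ℂ => if q.2.2.2 then z.im else z.re)
        ((fundamentalRep (Fin 2) (V q.1) : Matrix (Fin 2) (Fin 2) ℂ) q.2.1 q.2.2.1)
    let A : GaugeConfig 3 L (Matrix.specialUnitaryGroup (Fin 2) ℂ) → (Edge 3 L × Fin 2 × Fin 2 × Bool) →
        (Edge 3 L × Fin 2 × Fin 2 × Bool) → ℝ := fun V i j =>
      ∑ n : Edge 3 L × NoiseIdx 2,
        (if n.1 = i.1 then (fun z : ℂ => if i.2.2.2 then z.im else z.re)
          ((latticeLangevinDynamics (fundamentalLatticeRep 2) β').noise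
            (matrixConfig (fundamentalRep (Fin 2)) V) i.1 n.2 i.2.1 i.2.2.1) else 0) *
        (if n.1 = j.1 then (fun z : ℂ => if j.2.2.2 then z.im else z.re)
          ((latticeLangevinDynamics (fundamentalLatticeRep 2) β').noise
            (matrixConfig (fundamentalRep (Fin 2)) V) j.1 n.2 j.2.1 j.2.2.1) else 0)
    (∀ V, (∑ i : Edge 3 L × Fin 2 × Fin 2 × Bool, ∑ j : Edge 3 L × Fin 2 × Fin 2 × Bool, fderiv ℝ f (coords V) (Pi.single i 1) * fderiv ℝ f (coords V) (Pi.single j 1) * A V i j) ≤ s) →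
      ∀ (ν : Measure (GaugeConfig 3 L (Matrix.specialUnitaryGroup (Fin 2) ℂ))) [IsProbabilityMeasure ν],
        klDiv ν (wilsonMeasure (d := 3) (L := L) (fundamentalRep (Fin 2)) β') ≠ ∞ →
        |(∫ V, f (coords V) ∂ν) - ∫ V, f (coords V) ∂(wilsonMeasure (d := 3) (L := L) (fundamentalRep (Fin 2)) β')| ≤
          Real.sqrt (s * (klDiv ν (wilsonMeasure (d := 3) (L := L) (fundamentalRep (Fin 2)) β')).toReal / (1 - 12 * |β'|)) := by
  intro coords A hΓ ν hν hfin
  classical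
  haveI := secondCountableTopology_su2
  haveI := borelSpace_config L
  haveI : IsProbabilityMeasure (wilsonMeasure (d := 3) (L := L) (fundamentalRep (Fin 2)) β') :=
    isProbabilityMeasure_wilsonMeasure (d := 3) (L := L) (fundamentalRep (Fin 2)) (continuous_fundamentalRep (Fin 2)) β'
  have hρ : 0 < 1 - 12 * |β'| := by linarith
  have hco : Continuous coords := continuous_coords (L := L)
  have hFc : Continuous fun V => f (coords V) := hf.continuous.comp hco
  obtain ⟨M, hM⟩ : ∃ M, ∀ V : (GaugeConfig 3 L (Matrix.specialUnitaryGroup (Fin 2) ℂ)), |f (coords V)| ≤ M := by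
    obtain ⟨M, hM⟩ := isCompact_univ.exists_bound_of_continuousOn hFc.continuousOn
    exact ⟨M, fun V => by simpa [Real.norm_eq_abs] using hM V (Set.mem_univ V)⟩
  have hv : 0 < s / (2 * (1 - 12 * |β'|)) := by positivity
  have hmgf : ∀ t : ℝ, Real.log (∫ V, Real.exp (t * (f (coords V) - ∫ V', f (coords V') ∂(wilsonMeasure (d := 3) (L := L) (fundamentalRep (Fin 2)) β'))) ∂(wilsonMeasure (d := 3) (L := L) (fundamentalRep (Fin 2)) β')) ≤
      s / (2 * (1 - 12 * |β'|)) * t ^ 2 / 2 := fun t => wilson_logmgf_le_uniform L β' s f hf hβ hΓ t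
  have h := Literature.Probability.Entropy.abs_integral_sub_integral_le_sqrt_of_subGaussian
    (μ := (wilsonMeasure (d := 3) (L := L) (fundamentalRep (Fin 2)) β')) hFc.measurable hM hv hmgf hfin
  have e : 2 * (s / (2 * (1 - 12 * |β'|))) * (klDiv ν (wilsonMeasure (d := 3) (L := L) (fundamentalRep (Fin 2)) β')).toReal =
      s * (klDiv ν (wilsonMeasure (d := 3) (L := L) (fundamentalRep (Fin 2)) β')).toReal / (1 - 12 * |β'|) := by
    field_simp
  rw [e] at h
  exact h

/-! ## §3. Cold-start equilibration of smooth observables: rate `1 − 12|β'|`, prefactor `√(s · KL)` -/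

/-- ★★★ **Cold-start equilibration of a smooth observable, volume-uniform rate and entropy-weighted prefactor.**  For every `L`,
`|β'| < 1/12`, `f ∈ C³` with `Γ(f) ≤ s` (`s > 0`), every solution `U` of the SU(2) SZZ dynamics from a deterministic start on any
probability space, every `τ₀ > 0` and every `u ≥ 0`:
`|E f(coords U_(τ₀+u)) − ∫ f∘coords dμ_(β')| ≤ e^(−(1−12|β'|)u) · √(s · KL(law U_(τ₀) ‖ μ_(β')) / (1 − 12|β'|))`
(transport–entropy inequality at `ν = law U_(τ₀+u)` + g26's uniform KL decay `wilson_klDiv_map_le_exp_uniform`). [cite: ShenZhuZhu2022, §4 Theorem 4.2] -/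
theorem wilson_coldStart_smooth_le_exp_uniform (L : ℕ) [NeZero L] (β' : ℝ) (hβ : |β'| < 1 / 12)
    (f : (Edge 3 L × Fin 2 × Fin 2 × Bool → ℝ) → ℝ) (hf : ContDiff ℝ 3 f) {s : ℝ} (hs : 0 < s)
    {Ω : Type} [MeasurableSpace Ω] {P : Measure Ω} [IsProbabilityMeasure P]
    {W : ℝ≥0 → Ω → (Edge 3 L × NoiseIdx 2 → ℝ)} (hW : IsFlatBrownian W P)
    {U : ℝ≥0 → Ω → GaugeConfig 3 L (Matrix.specialUnitaryGroup (Fin 2) ℂ)}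
    (z : GaugeConfig 3 L (Matrix.specialUnitaryGroup (Fin 2) ℂ)) (hU0 : ∀ ω, U 0 ω = z)
    (hU : (latticeLangevinDynamics (fundamentalLatticeRep 2) β').IsSolution (fundamentalRep (Fin 2)) hW.natFiltration P W U)
    {τ₀ : ℝ≥0} (hτ₀ : 0 < (τ₀ : ℝ)) (u : ℝ≥0) :
    let coords : GaugeConfig 3 L (Matrix.specialUnitaryGroup (Fin 2) ℂ) → (Edge 3 L × Fin 2 × Fin 2 × Bool → ℝ) :=
      fun V q => (fun z : ℂ => if q.2.2.2 then z.im else z.re)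
        ((fundamentalRep (Fin 2) (V q.1) : Matrix (Fin 2) (Fin 2) ℂ) q.2.1 q.2.2.1)
    let A : GaugeConfig 3 L (Matrix.specialUnitaryGroup (Fin 2) ℂ) → (Edge 3 L × Fin 2 × Fin 2 × Bool) →
        (Edge 3 L × Fin 2 × Fin 2 × Bool) → ℝ := fun V i j =>
      ∑ n : Edge 3 L × NoiseIdx 2,
        (if n.1 = i.1 then (fun z : ℂ => if i.2.2.2 then z.im else z.re)
          ((latticeLangevinDynamics (fundamentalLatticeRep 2) β').noise
            (matrixConfig (fundamentalRep (Fin 2)) V) i.1 n.2 i.2.1 i.2.2.1) else 0) *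
        (if n.1 = j.1 then (fun z : ℂ => if j.2.2.2 then z.im else z.re)
          ((latticeLangevinDynamics (fundamentalLatticeRep 2) β').noise
            (matrixConfig (fundamentalRep (Fin 2)) V) j.1 n.2 j.2.1 j.2.2.1) else 0)
    (∀ V, (∑ i : Edge 3 L × Fin 2 × Fin 2 × Bool, ∑ j : Edge 3 L × Fin 2 × Fin 2 × Bool, fderiv ℝ f (coords V) (Pi.single i 1) * fderiv ℝ f (coords V) (Pi.single j 1) * A V i j) ≤ s) →
      |(∫ ω, f (coords (U (τ₀ + u) ω)) ∂P) - ∫ V, f (coords V) ∂(wilsonMeasure (d := 3) (L := L) (fundamentalRep (Fin 2)) β')| ≤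
        Real.exp (-(1 - 12 * |β'|) * u) * Real.sqrt (s * (klDiv (P.map (U τ₀)) (wilsonMeasure (d := 3) (L := L) (fundamentalRep (Fin 2)) β')).toReal / (1 - 12 * |β'|)) := by
  intro coords A hΓ
  classical
  haveI := secondCountableTopology_su2
  haveI := borelSpace_config L
  haveI : IsProbabilityMeasure (wilsonMeasure (d := 3) (L := L) (fundamentalRep (Fin 2)) β') :=
    isProbabilityMeasure_wilsonMeasure (d := 3) (L := L) (fundamentalRep (Fin 2)) (continuous_fundamentalRep (Fin 2)) β'
  have hρ : 0 < 1 - 12 * |β'| := by linarith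
  have hco : Continuous coords := continuous_coords (L := L)
  have hFc : Continuous fun V => f (coords V) := hf.continuous.comp hco
  have hmU : ∀ t : ℝ≥0, Measurable (U t) := fun t => (hU.adapted t).mono (hW.natFiltration.le t) le_rfl
  haveI : IsProbabilityMeasure (P.map (U (τ₀ + u))) := Measure.isProbabilityMeasure_map (hmU _).aemeasurable
  have hdec := wilson_klDiv_map_le_exp_uniform L β' hβ hW z hU0 hU hτ₀ u
  have hfin : klDiv (P.map (U (τ₀ + u))) (wilsonMeasure (d := 3) (L := L) (fundamentalRep (Fin 2)) β') ≠ ∞ :=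
    ne_top_of_le_ne_top ENNReal.ofReal_ne_top hdec
  have hT := wilson_transport_le_sqrt_uniform L β' f hf hs hβ hΓ (P.map (U (τ₀ + u))) hfin
  rw [integral_map (hmU _).aemeasurable hFc.measurable.aestronglyMeasurable] at hT
  refine hT.trans ?_
  -- `√(s·KL_(τ₀+u)/ρ) ≤ e^(−ρu) √(s·KL_(τ₀)/ρ)`
  have hK0 : 0 ≤ (klDiv (P.map (U τ₀)) (wilsonMeasure (d := 3) (L := L) (fundamentalRep (Fin 2)) β')).toReal := ENNReal.toReal_nonneg
  have hle : (klDiv (P.map (U (τ₀ + u))) (wilsonMeasure (d := 3) (L := L) (fundamentalRep (Fin 2)) β')).toReal ≤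
      Real.exp (-(2 * (1 - 12 * |β'|)) * u) * (klDiv (P.map (U τ₀)) (wilsonMeasure (d := 3) (L := L) (fundamentalRep (Fin 2)) β')).toReal := by
    have h := ENNReal.toReal_mono ENNReal.ofReal_ne_top hdec
    rwa [ENNReal.toReal_ofReal (mul_nonneg (Real.exp_pos _).le hK0)] at h
  have hsq : Real.sqrt (s * (klDiv (P.map (U (τ₀ + u))) (wilsonMeasure (d := 3) (L := L) (fundamentalRep (Fin 2)) β')).toReal / (1 - 12 * |β'|)) ≤
      Real.sqrt (s * (Real.exp (-(2 * (1 - 12 * |β'|)) * u) * (klDiv (P.map (U τ₀)) (wilsonMeasure (d := 3) (L := L) (fundamentalRep (Fin 2)) β')).toReal) / (1 - 12 * |β'|)) :=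
    Real.sqrt_le_sqrt (div_le_div_of_nonneg_right (mul_le_mul_of_nonneg_left hle hs.le) hρ.le)
  refine hsq.trans (le_of_eq ?_)
  have hexp : Real.exp (-(2 * (1 - 12 * |β'|)) * (u : ℝ)) = (Real.exp (-(1 - 12 * |β'|) * u)) ^ 2 := by
    rw [sq, ← Real.exp_add]; congr 1; ring
  rw [hexp, show s * ((Real.exp (-(1 - 12 * |β'|) * (u : ℝ))) ^ 2 * (klDiv (P.map (U τ₀)) (wilsonMeasure (d := 3) (L := L) (fundamentalRep (Fin 2)) β')).toReal) / (1 - 12 * |β'|) =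
      (Real.exp (-(1 - 12 * |β'|) * (u : ℝ))) ^ 2 * (s * (klDiv (P.map (U τ₀)) (wilsonMeasure (d := 3) (L := L) (fundamentalRep (Fin 2)) β')).toReal / (1 - 12 * |β'|)) by ring,
    Real.sqrt_mul' _ (div_nonneg (mul_nonneg hs.le hK0) hρ.le), Real.sqrt_sq (Real.exp_pos _).le]

/-- ★★★ **Cold-start equilibration of a smooth observable with the EXPLICIT budget** (`τ₀ = 2` lattice units): for every `L`, `|β'| < 1/12`,
`f ∈ C³` with `Γ(f) ≤ s` (`s > 0`), every solution from a deterministic start and every `u ≥ 0`,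
`|E f(coords U_(2+u)) − ∫ f∘coords dμ_(β')| ≤ e^(−(1−12|β'|)u) · √(s · (366|β'|L³ + 3 log(3/2) L³ + log 2) / (1 − 12|β'|))`.
When `s = O(1/L³)` (spatial averages) the prefactor is `O(1)` in `L`. [cite: ShenZhuZhu2022, §4 Theorem 4.2] -/
theorem wilson_coldStart_smooth_le_exp_explicit (L : ℕ) [NeZero L] (β' : ℝ) (hβ : |β'| < 1 / 12)
    (f : (Edge 3 L × Fin 2 × Fin 2 × Bool → ℝ) → ℝ) (hf : ContDiff ℝ 3 f) {s : ℝ} (hs : 0 < s)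
    {Ω : Type} [MeasurableSpace Ω] {P : Measure Ω} [IsProbabilityMeasure P]
    {W : ℝ≥0 → Ω → (Edge 3 L × NoiseIdx 2 → ℝ)} (hW : IsFlatBrownian W P)
    {U : ℝ≥0 → Ω → GaugeConfig 3 L (Matrix.specialUnitaryGroup (Fin 2) ℂ)}
    (z : GaugeConfig 3 L (Matrix.specialUnitaryGroup (Fin 2) ℂ)) (hU0 : ∀ ω, U 0 ω = z)
    (hU : (latticeLangevinDynamics (fundamentalLatticeRep 2) β').IsSolution (fundamentalRep (Fin 2)) hW.natFiltration P W U)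
    (u : ℝ≥0) :
    let coords : GaugeConfig 3 L (Matrix.specialUnitaryGroup (Fin 2) ℂ) → (Edge 3 L × Fin 2 × Fin 2 × Bool → ℝ) :=
      fun V q => (fun z : ℂ => if q.2.2.2 then z.im else z.re)
        ((fundamentalRep (Fin 2) (V q.1) : Matrix (Fin 2) (Fin 2) ℂ) q.2.1 q.2.2.1)
    let A : GaugeConfig 3 L (Matrix.specialUnitaryGroup (Fin 2) ℂ) → (Edge 3 L × Fin 2 × Fin 2 × Bool) →
        (Edge 3 L × Fin 2 × Fin 2 × Bool) → ℝ := fun V i j =>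
      ∑ n : Edge 3 L × NoiseIdx 2,
        (if n.1 = i.1 then (fun z : ℂ => if i.2.2.2 then z.im else z.re)
          ((latticeLangevinDynamics (fundamentalLatticeRep 2) β').noise
            (matrixConfig (fundamentalRep (Fin 2)) V) i.1 n.2 i.2.1 i.2.2.1) else 0) *
        (if n.1 = j.1 then (fun z : ℂ => if j.2.2.2 then z.im else z.re)
          ((latticeLangevinDynamics (fundamentalLatticeRep 2) β').noise
            (matrixConfig (fundamentalRep (Fin 2)) V) j.1 n.2 j.2.1 j.2.2.1) else 0)
    (∀ V, (∑ i : Edge 3 L × Fin 2 × Fin 2 × Bool, ∑ j : Edge 3 L × Fin 2 × Fin 2 × Bool, fderiv ℝ f (coords V) (Pi.single i 1) * fderiv ℝ f (coords V) (Pi.single j 1) * A V i j) ≤ s) →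
      |(∫ ω, f (coords (U ((2 : ℝ≥0) + u) ω)) ∂P) - ∫ V, f (coords V) ∂(wilsonMeasure (d := 3) (L := L) (fundamentalRep (Fin 2)) β')| ≤
        Real.exp (-(1 - 12 * |β'|) * u) * Real.sqrt (s * (366 * |β'| * (L : ℝ) ^ 3 + 3 * Real.log (3 / 2) * (L : ℝ) ^ 3 + Real.log 2) / (1 - 12 * |β'|)) := by
  intro coords A hΓ
  have hρ : 0 < 1 - 12 * |β'| := by linarith
  have ht₁ : 0 < ((2 : ℝ≥0) : ℝ) := by norm_num
  have h := wilson_coldStart_smooth_le_exp_uniform L β' hβ f hf hs hW z hU0 hU ht₁ u hΓ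
  have hb := wilson_klDiv_map_le_explicit L β' z hW hU0 hU 0
  rw [add_zero] at hb
  have hBpos := burnInBudget_pos L β'
  have hK : (klDiv (P.map (U (2 : ℝ≥0))) (wilsonMeasure (d := 3) (L := L) (fundamentalRep (Fin 2)) β')).toReal ≤ (366 * |β'| * (L : ℝ) ^ 3 + 3 * Real.log (3 / 2) * (L : ℝ) ^ 3 + Real.log 2) := by
    have h' := ENNReal.toReal_mono ENNReal.ofReal_ne_top hb
    rwa [ENNReal.toReal_ofReal hBpos.le] at h'
  refine h.trans (mul_le_mul_of_nonneg_left (Real.sqrt_le_sqrt ?_) (Real.exp_pos _).le)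
  exact div_le_div_of_nonneg_right (mul_le_mul_of_nonneg_left hK hs.le) hρ.le

/-- ★★★ **Volume-independent mixing-time bound for smooth observables.**  For the SU(2) SZZ dynamics on `(ℤ/L)³` at `|β'| < 1/12`, with
`B_L = 366|β'|L³ + 3 log(3/2) L³ + log 2`, `ρ = 1 − 12|β'|` and a `C³` observable `f` with `Γ(f) ≤ s` (`s > 0`): for every `ε > 0` and
every `u ≥ log(√(s B_L/ρ)/ε)/ρ`, every deterministic start and every solution, `|E f(coords U_(2+u)) − ∫ f∘coords dμ_(β')| ≤ ε`.  For a
spatially averaged observable (`s ≍ 1/L³`) the threshold does not grow with `L`. [cite: ShenZhuZhu2022, §4 Theorem 4.2, Corollary 4.4] -/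
theorem wilson_coldStart_smooth_mixingTime (L : ℕ) [NeZero L] (β' : ℝ) (hβ : |β'| < 1 / 12)
    (f : (Edge 3 L × Fin 2 × Fin 2 × Bool → ℝ) → ℝ) (hf : ContDiff ℝ 3 f) {s : ℝ} (hs : 0 < s)
    {Ω : Type} [MeasurableSpace Ω] {P : Measure Ω} [IsProbabilityMeasure P]
    {W : ℝ≥0 → Ω → (Edge 3 L × NoiseIdx 2 → ℝ)} (hW : IsFlatBrownian W P)
    {U : ℝ≥0 → Ω → GaugeConfig 3 L (Matrix.specialUnitaryGroup (Fin 2) ℂ)}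
    (z : GaugeConfig 3 L (Matrix.specialUnitaryGroup (Fin 2) ℂ)) (hU0 : ∀ ω, U 0 ω = z)
    (hU : (latticeLangevinDynamics (fundamentalLatticeRep 2) β').IsSolution (fundamentalRep (Fin 2)) hW.natFiltration P W U)
    {ε : ℝ} (hε : 0 < ε) (u : ℝ≥0)
    (hu : Real.log (Real.sqrt (s * (366 * |β'| * (L : ℝ) ^ 3 + 3 * Real.log (3 / 2) * (L : ℝ) ^ 3 + Real.log 2) / (1 - 12 * |β'|)) / ε) / (1 - 12 * |β'|) ≤ (u : ℝ)) :
    let coords : GaugeConfig 3 L (Matrix.specialUnitaryGroup (Fin 2) ℂ) → (Edge 3 L × Fin 2 × Fin 2 × Bool → ℝ) :=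
      fun V q => (fun z : ℂ => if q.2.2.2 then z.im else z.re)
        ((fundamentalRep (Fin 2) (V q.1) : Matrix (Fin 2) (Fin 2) ℂ) q.2.1 q.2.2.1)
    let A : GaugeConfig 3 L (Matrix.specialUnitaryGroup (Fin 2) ℂ) → (Edge 3 L × Fin 2 × Fin 2 × Bool) →
        (Edge 3 L × Fin 2 × Fin 2 × Bool) → ℝ := fun V i j =>
      ∑ n : Edge 3 L × NoiseIdx 2,
        (if n.1 = i.1 then (fun z : ℂ => if i.2.2.2 then z.im else z.re)
          ((latticeLangevinDynamics (fundamentalLatticeRep 2) β').noise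
            (matrixConfig (fundamentalRep (Fin 2)) V) i.1 n.2 i.2.1 i.2.2.1) else 0) *
        (if n.1 = j.1 then (fun z : ℂ => if j.2.2.2 then z.im else z.re)
          ((latticeLangevinDynamics (fundamentalLatticeRep 2) β').noise
            (matrixConfig (fundamentalRep (Fin 2)) V) j.1 n.2 j.2.1 j.2.2.1) else 0)
    (∀ V, (∑ i : Edge 3 L × Fin 2 × Fin 2 × Bool, ∑ j : Edge 3 L × Fin 2 × Fin 2 × Bool, fderiv ℝ f (coords V) (Pi.single i 1) * fderiv ℝ f (coords V) (Pi.single j 1) * A V i j) ≤ s) →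
      |(∫ ω, f (coords (U ((2 : ℝ≥0) + u) ω)) ∂P) - ∫ V, f (coords V) ∂(wilsonMeasure (d := 3) (L := L) (fundamentalRep (Fin 2)) β')| ≤ ε := by
  intro coords A hΓ
  have hρ : 0 < 1 - 12 * |β'| := by linarith
  have h := wilson_coldStart_smooth_le_exp_explicit L β' hβ f hf hs hW z hU0 hU u hΓ
  have hBpos := burnInBudget_pos L β'
  obtain ⟨S, hS⟩ : ∃ S : ℝ, Real.sqrt (s * (366 * |β'| * (L : ℝ) ^ 3 + 3 * Real.log (3 / 2) * (L : ℝ) ^ 3 + Real.log 2) / (1 - 12 * |β'|)) = S := ⟨_, rfl⟩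
  rw [hS] at h hu
  have hSpos : 0 < S := by rw [← hS]; exact Real.sqrt_pos.2 (by positivity)
  refine h.trans ?_
  -- `e^(−ρu) ≤ ε / S`
  have hu' : Real.log (S / ε) ≤ (1 - 12 * |β'|) * u := by
    rw [div_le_iff₀ hρ] at hu
    linarith
  have hexp : Real.exp (-(1 - 12 * |β'|) * u) ≤ ε / S := by
    have h1 : Real.exp (-(1 - 12 * |β'|) * u) ≤ Real.exp (-Real.log (S / ε)) := Real.exp_le_exp.2 (by linarith)
    rw [Real.exp_neg, Real.exp_log (div_pos hSpos hε), inv_div] at h1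
    exact h1
  calc Real.exp (-(1 - 12 * |β'|) * u) * S ≤ ε / S * S := mul_le_mul_of_nonneg_right hexp hSpos.le
    _ = ε := div_mul_cancel₀ ε hSpos.ne'

end Summit.QuantumFields.YangMills.Theorems.ColdStartUniversality
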